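import Summits.ResolutionOfSingularities.ResolutionOfSingularities.Theorems.EquisingularLiftEquisingularLiftNatClusterLiftTangentWitness
import Summits.ResolutionOfSingularities.ResolutionOfSingularities.Theorems.EquisingularLiftEquisingularLiftNatClusterStepDischarge
import Summits.ResolutionOfSingularities.ResolutionOfSingularities.Theorems.EquisingularLiftEquisingularLiftNatClusterStepTangentDefs
import Summits.ResolutionOfSingularities.ResolutionOfSingularities.Theorems.EquisingularLiftEquisingularLiftNatDeltaConeLiftPlane
import Summits.ResolutionOfSingularities.ResolutionOfSingularities.Theorems.EquisingularLiftEquisingularLiftNatSquarefreeInitialForm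
import HarnessLib

/-!
# [OURS · L1 W4.5(b) · EL♮(3)] (δ) D1 ★ CLUSTER-CONE — the Δ-regular cone centred EXACTLY at a SUB-CLUSTER `S`: res-L1-w45b-stub-3's
# T-CLUSTER-LIFT part 9 (`exists_isHomogeneous_clusterLift_deltaRegular_stCharts`, p531761) instantiated from the CLUSTERSTEP data of
# rung v7′ (TC⁺⁺) — `FatCluster`, `ClusterNonSuperabundant`, `ClusterTangentWitness` — with every witness and finiteness input discharged
# (crux `EquisingularLiftNatThree` stmt-ResolutionOfSingularities-20148 / parent 20038; registered stub `stub_elnat_tcPlusPlusPointResolution` v2)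

NOT a statement of any manuscript. Helper file of the chain res-L1-w45b (cell `res-hironaka`, LADDER-RESOLUTION rung L, slot W4.5(b));
OURS; AI-written, weaker than expert review; `--supports stmt-ResolutionOfSingularities-20148 --as helper` by res-L1-w45b-stub-3 (brick D1 of
the (δ) plan `L/res-L1-w45b-stub-3/DELTA-PLAN.md`, STEP 0 per subset of the TC⁺⁺ invariant `TCPlusPlus.Inv`). No `sorry`; standard axioms.

WHAT. For the member of `TCPlusPlus.Inv` indexed by a subset `S` of the fat cluster (the points the member is CENTRED at), the in-carrier
cone must be a form `Φ_S ∈ O[T₀,T₁,T₂]_dg` lifting the reduced tangent form `g`, of order `m_t` along the section over `a_t` for `t ∈ S`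
(and EXACTLY `m_t`: a unit coefficient in order `m_t`, so that the centred package's cone form is exact — res-L1-w45b-stub-3 B6c's
`hexact`), Δ-regular on the standard charts at every prime over `ϖ` lying over a point that is NOT an `S`-point (read on the chart of a
non-`S` cluster point: regularity there is what Member clause (v) needs), and with Δ-regular strict transforms on the charts of the blow-up
of each `a_t`, `t ∈ S`, at every prime over `ϖ` ON THE EXCEPTIONAL LINE `X_p = 0` (the infinitely-near points — the only ones the cone
point's `ConeDeltaRegular` sees, res-L1-w45b-stub-3 `isRegularLocalRing_quot_of_planeChart_over`, p541387).

* **`exists_clusterConeLift_subset`** — exactly that, from: `O` a DVR, `π : O ↠ k` onto an infinite field with `ker π = (ϖ)`, `g` homogeneous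
  of degree `dg`, non-zero, square-free; a cluster `(s, i, a, m)` with coordinates `a` over `O` such that the reduced cluster `(i, π∘a, m)`
  is a `FatCluster` of `g`, `ClusterNonSuperabundant` and has the `ClusterTangentWitness`; any `S ⊆ Fin s`.
  Instantiation of part 9 at `ι := ↥S`: `hind` := `clusterNonSuperabundant_mono`; excluded sets `E j` := the chart-`j` point ideals of the
  cluster points that are in `S` or are read on another chart (`i t ≠ j`) — by COVER every bad prime off `E j` is the SAME-CHART point of a
  non-`S` cluster point `t′`, where the witness «jets `0` at `S`, value `1` at `t′`» from `ClusterNonSuperabundant` does not vanish;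
  `E′ t p` := the primes NOT containing `X_p`, so only the infinitely-near bad points need the witness, which is the TANGENT WITNESS of part 11
  (`exists_clusterForm_stChart_sub_one_mem`: `Mst ≡ 1 mod X_p`); ONE form `M̄` for all conditions by part 11's
  `exists_clusterForm_forall_linear_notMem`; finiteness from square-freeness (`finite_setOf_mem_sq_chart`, part 10 `finite_setOf_mem_sq_stChart`).

References: parts 8–11 of T-CLUSTER-LIFT (p530102, p531761, p533598, p535261), …NatClusterStepDischarge (p532712), res-L1-w45b-lead-2
…NatClusterStepDefs / …TangentDefs (p531557, p536699); H. Matsumura, *Commutative Ring Theory* (1986), Thm. 14.2 [cite: Matsumura1987].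
-/

set_option linter.dupNamespace false -- mandated namespace `Summit.<Summit>.<Problem>` of this single-conjunct summit
set_option linter.overlappingInstances false -- signatures carry `[IsDomain O] [IsDiscreteValuationRing O]`

noncomputable section

namespace Summit.ResolutionOfSingularities.ResolutionOfSingularities.Cruxes.EquisingularLiftNat.Sections

open MvPolynomial IsLocalRing Literature.AlgebraicGeometry.Resolution
open Summit.ResolutionOfSingularities.ResolutionOfSingularities.Theorems
open Summit.ResolutionOfSingularities.ResolutionOfSingularities.Theorems.EquisingularLiftNat.ClusterLift

/-- Restricting `Function.update` along a subtype: updating `m ∘ val` at `t₀` and reading at `t` is updating `m` at `t₀.1` and reading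
at `t.1`. [folklore] -/
theorem update_comp_subtype_apply {s : ℕ} {S : Set (Fin s)} (m : Fin s → ℕ) (t₀ t : S) (x : ℕ) :
    Function.update (fun t : S => m t.1) t₀ x t = Function.update m t₀.1 x t.1 := by
  by_cases h : t = t₀
  · subst h; simp
  · have h' : t.1 ≠ t₀.1 := fun e => h (Subtype.ext e)
    rw [Function.update_of_ne h, Function.update_of_ne h']

/-- A form prescribed by `ClusterNonSuperabundant` to have zero jets at the other points and constant jet `1` at `t′` does not vanish at
`a_{t′}` and has order `≥ m_t` at every `t ≠ t′`. [OURS · L1 W4.5b] -/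
theorem exists_form_notMem_point_of_clusterNonSuperabundant {k : Type} [Field k] {dg s : ℕ} (i : Fin s → Fin 3)
    (a : (t : Fin s) → {j : Fin 3 // j ≠ i t} → k) (m : Fin s → ℕ) (hns : ClusterNonSuperabundant dg s i a m)
    (t' : Fin s) (ht' : 1 ≤ m t') :
    ∃ w : MvPolynomial (Fin 3) k, w.IsHomogeneous dg ∧
      (∀ t, t ≠ t' → dehomogenize (i t) w ∈
        (Ideal.span (Set.range fun l => (X l : MvPolynomial {l : Fin 3 // l ≠ i t} k) - C (a t l))) ^ m t) ∧
      dehomogenize (i t') w ∉ Ideal.span (Set.range fun l => (X l : MvPolynomial {l : Fin 3 // l ≠ i t'} k) - C (a t' l)) := by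
  classical
  obtain ⟨w, hw, hjet⟩ := hns fun t α => if t = t' ∧ α = 0 then 1 else 0
  refine ⟨w, hw, fun t ht => ?_, ?_⟩
  · rw [mem_pow_span_X_sub_C_iff]
    intro α hα
    rw [hjet t α hα, if_neg (fun h => ht h.1)]
  · intro hmem
    have h1 := (mem_pow_span_X_sub_C_iff (a t') 1 (dehomogenize (i t') w)).mp (by rw [pow_one]; exact hmem) 0
      (by rw [map_zero]; exact zero_lt_one)
    rw [hjet t' 0 (by rw [map_zero]; exact ht'), if_pos ⟨rfl, rfl⟩] at h1
    exact one_ne_zero h1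

set_option maxHeartbeats 800000 in -- one witness form serving every chart condition: large finite bookkeeping
/-- **(δ) D1 ★ — the Δ-regular cone centred exactly at a sub-cluster.** See the module docstring.
[cite: Matsumura1987, Thm. 14.2] [OURS · L1 W4.5b] (δ) STEP 0 per subset; NOT a statement of the manuscript. -/
theorem exists_clusterConeLift_subset {O : Type} [CommRing O] [IsDomain O] [IsDiscreteValuationRing O] {ϖ : O}
    (hϖ : Irreducible ϖ) {k : Type} [Field k] [Infinite k] (π : O →+* k) (hπ : Function.Surjective π)
    (hker : RingHom.ker π = Ideal.span {ϖ}) {dg s : ℕ} (g : MvPolynomial (Fin 3) k) (hg : g.IsHomogeneous dg) (hg0 : g ≠ 0)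
    (hgsq : Squarefree g) (i : Fin s → Fin 3) (a : (t : Fin s) → {j : Fin 3 // j ≠ i t} → O) (m : Fin s → ℕ)
    (hF : FatCluster g s i (fun t j => π (a t j)) m) (hns : ClusterNonSuperabundant dg s i (fun t j => π (a t j)) m)
    (htw : ClusterTangentWitness dg s i (fun t j => π (a t j)) m) (S : Set (Fin s)) :
    ∃ Φ : MvPolynomial (Fin 3) O, Φ.IsHomogeneous dg ∧ MvPolynomial.map π Φ = g ∧
      -- centred of order `m t` at the points of `S`, EXACTLY
      (∀ t ∈ S, dehomogenize (i t) Φ ∈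
        (Ideal.span (Set.range fun j => (X j : MvPolynomial {j : Fin 3 // j ≠ i t} O) - C (a t j))) ^ m t) ∧
      (∀ t ∈ S, ∃ α : {j : Fin 3 // j ≠ i t} →₀ ℕ, α.degree = m t ∧
        IsUnit (coeff α (aeval (fun l => (X l : MvPolynomial {j : Fin 3 // j ≠ i t} O) + C (a t l)) (dehomogenize (i t) Φ)))) ∧
      -- standard charts: Δ-regular at every prime over `ϖ` off the chart-`j` points of `S` and off the other-chart cluster points
      (∀ (j : Fin 3) (Q : Ideal (MvPolynomial {l : Fin 3 // l ≠ j} O ⧸ Ideal.span {dehomogenize j Φ})) [Q.IsPrime],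
        Ideal.Quotient.mk (Ideal.span {dehomogenize j Φ}) (C ϖ : MvPolynomial {l : Fin 3 // l ≠ j} O) ∈ Q →
        (∀ t : Fin s, (if h : j = i t then (1 : k) else π (a t ⟨j, h⟩)) ≠ 0 → (t ∈ S ∨ i t ≠ j) →
          (Ideal.span (Set.range fun l : {l : Fin 3 // l ≠ j} =>
            (X l : MvPolynomial {l : Fin 3 // l ≠ j} k) -
              C ((if h : (l : Fin 3) = i t then (1 : k) else π (a t ⟨l, h⟩)) /
                (if h : j = i t then (1 : k) else π (a t ⟨j, h⟩))))).comap (MvPolynomial.map (σ := {l : Fin 3 // l ≠ j}) π) ≠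
          Q.comap (Ideal.Quotient.mk (Ideal.span {dehomogenize j Φ}))) →
        IsRegularLocalRing (Localization.AtPrime Q)) ∧
      -- strict-transform charts at the points of `S`: Δ-regular at every prime over `ϖ` on the exceptional line `X_p = 0`
      (∀ t ∈ S, ∀ p : {j : Fin 3 // j ≠ i t}, ∃ Φst : MvPolynomial {j : Fin 3 // j ≠ i t} O,
        (X p : MvPolynomial {j : Fin 3 // j ≠ i t} O) ^ m t * Φst =
          aeval (fun j => if j = p then (X p : MvPolynomial {j : Fin 3 // j ≠ i t} O) else X p * X j)
            (aeval (fun l => (X l : MvPolynomial {j : Fin 3 // j ≠ i t} O) + C (a t l)) (dehomogenize (i t) Φ)) ∧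
        ∀ (Q : Ideal (MvPolynomial {j : Fin 3 // j ≠ i t} O ⧸ Ideal.span {Φst})) [Q.IsPrime],
          Ideal.Quotient.mk (Ideal.span {Φst}) (C ϖ : MvPolynomial {j : Fin 3 // j ≠ i t} O) ∈ Q →
          Ideal.Quotient.mk (Ideal.span {Φst}) (X p : MvPolynomial {j : Fin 3 // j ≠ i t} O) ∈ Q →
          IsRegularLocalRing (Localization.AtPrime Q)) := by
  classical
  obtain ⟨hord, hdist, hcover⟩ := hF
  -- the sub-cluster indexed by `↥S`
  let iS : S → Fin 3 := fun t => i t.1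
  let aS : (t : S) → {j : Fin 3 // j ≠ iS t} → O := fun t => a t.1
  let mS : S → ℕ := fun t => m t.1
  -- reduced traces: square-free on every chart, of exact order at the cluster points
  have hgsqj : ∀ j : Fin 3, Squarefree (dehomogenize j g) := fun j => squarefree_dehomogenize_of_isHomogeneous j hg hgsq
  have hg0j : ∀ j : Fin 3, dehomogenize j g ≠ 0 := fun j => dehomogenize_ne_zero_of_isHomogeneous j hg hg0
  -- independence clause for the sub-cluster
  have hind : ∀ v : (t : S) → ({j : Fin 3 // j ≠ iS t} →₀ ℕ) → k, ∃ g' : MvPolynomial (Fin 3) k, g'.IsHomogeneous dg ∧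
      ∀ t α, α.degree < mS t →
        coeff α (aeval (fun j => (X j : MvPolynomial {j : Fin 3 // j ≠ iS t} k) + C (π (aS t j))) (dehomogenize (iS t) g')) =
          v t α :=
    clusterNonSuperabundant_mono S i (fun t j => π (a t j)) m hns
  have hgZ : ∀ t : S, dehomogenize (iS t) g ∈
      (Ideal.span (Set.range fun j => (X j : MvPolynomial {j : Fin 3 // j ≠ iS t} k) - C (π (aS t j)))) ^ mS t :=
    fun t => (hord t.1).1
  -- excluded sets on the standard charts: `S`-points and other-chart cluster points
  let E : (j : Fin 3) → Set (PrimeSpectrum (MvPolynomial {l : Fin 3 // l ≠ j} k)) := fun j =>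
    {𝔮 | ∃ t : Fin s, (if h : j = i t then (1 : k) else π (a t ⟨j, h⟩)) ≠ 0 ∧
      𝔮.asIdeal = Ideal.span (Set.range fun l : {l : Fin 3 // l ≠ j} =>
        (X l : MvPolynomial {l : Fin 3 // l ≠ j} k) -
          C ((if h : (l : Fin 3) = i t then (1 : k) else π (a t ⟨l, h⟩)) /
            (if h : j = i t then (1 : k) else π (a t ⟨j, h⟩)))) ∧ (t ∈ S ∨ i t ≠ j)}
  have hfin : ∀ j : Fin 3, {𝔮 : PrimeSpectrum (MvPolynomial {l : Fin 3 // l ≠ j} k) |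
      dehomogenize j g ∈ 𝔮.asIdeal ∧
      algebraMap (MvPolynomial {l : Fin 3 // l ≠ j} k) (Localization.AtPrime 𝔮.asIdeal) (dehomogenize j g) ∈
        maximalIdeal (Localization.AtPrime 𝔮.asIdeal) ^ 2}.Finite :=
    fun j => finite_setOf_mem_sq_chart j (hg0j j) (hgsqj j)
  -- strict-transform charts: the downstairs strict transforms, square-free, finitely many bad primes
  let gst : (t : S) → (p : {j : Fin 3 // j ≠ iS t}) → MvPolynomial {j : Fin 3 // j ≠ iS t} k := fun t p =>
    (aeval (fun j => if j = p then (X p : MvPolynomial {j : Fin 3 // j ≠ iS t} k) else X p * X j)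
      (aeval (fun l => (X l : MvPolynomial {j : Fin 3 // j ≠ iS t} k) + C (π (aS t l))) (dehomogenize (iS t) g))).divMonomial
      (Finsupp.single p (mS t))
  have hgst : ∀ t p, (X p : MvPolynomial {j : Fin 3 // j ≠ iS t} k) ^ mS t * gst t p =
      aeval (fun j => if j = p then (X p : MvPolynomial {j : Fin 3 // j ≠ iS t} k) else X p * X j)
        (aeval (fun l => (X l : MvPolynomial {j : Fin 3 // j ≠ iS t} k) + C (π (aS t l))) (dehomogenize (iS t) g)) :=
    fun t p => X_pow_mul_divMonomial_eq_of_mem p (blowupSubst_shift_mem_span_X_pow p _ (hgZ t))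
  let E' : (t : S) → (p : {j : Fin 3 // j ≠ iS t}) → Set (PrimeSpectrum (MvPolynomial {j : Fin 3 // j ≠ iS t} k)) :=
    fun t p => {𝔮 | (X p : MvPolynomial {j : Fin 3 // j ≠ iS t} k) ∉ 𝔮.asIdeal}
  have hfinst : ∀ t p, {𝔮 : PrimeSpectrum (MvPolynomial {j : Fin 3 // j ≠ iS t} k) | gst t p ∈ 𝔮.asIdeal ∧
      algebraMap (MvPolynomial {j : Fin 3 // j ≠ iS t} k) (Localization.AtPrime 𝔮.asIdeal) (gst t p) ∈
        maximalIdeal (Localization.AtPrime 𝔮.asIdeal) ^ 2}.Finite :=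
    fun t p => finite_setOf_mem_sq_stChart (iS t) p (fun l => π (aS t l)) (hgsqj (iS t)) (hord t.1).1 (hord t.1).2
  -- the genuine conditions: bad primes off `E j` (standard), bad primes on the exceptional line (strict transform)
  let BadStd : (j : Fin 3) → Set (PrimeSpectrum (MvPolynomial {l : Fin 3 // l ≠ j} k)) := fun j =>
    {𝔮 | (dehomogenize j g ∈ 𝔮.asIdeal ∧
      algebraMap (MvPolynomial {l : Fin 3 // l ≠ j} k) (Localization.AtPrime 𝔮.asIdeal) (dehomogenize j g) ∈
        maximalIdeal (Localization.AtPrime 𝔮.asIdeal) ^ 2) ∧ 𝔮 ∉ E j}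
  let BadSt : (t : S) → (p : {j : Fin 3 // j ≠ iS t}) → Set (PrimeSpectrum (MvPolynomial {j : Fin 3 // j ≠ iS t} k)) := fun t p =>
    {𝔮 | (gst t p ∈ 𝔮.asIdeal ∧
      algebraMap (MvPolynomial {j : Fin 3 // j ≠ iS t} k) (Localization.AtPrime 𝔮.asIdeal) (gst t p) ∈
        maximalIdeal (Localization.AtPrime 𝔮.asIdeal) ^ 2) ∧ (X p : MvPolynomial {j : Fin 3 // j ≠ iS t} k) ∈ 𝔮.asIdeal}
  have hBadStd : ∀ j, (BadStd j).Finite := fun j => (hfin j).subset fun 𝔮 h => h.1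
  have hBadSt : ∀ t p, (BadSt t p).Finite := fun t p => (hfinst t p).subset fun 𝔮 h => h.1
  let CondStd : Type := Σ j : Fin 3, BadStd j
  let CondSt : Type := Σ t : S, Σ p : {j : Fin 3 // j ≠ iS t}, BadSt t p
  haveI : Finite S := Subtype.finite
  haveI : Finite CondStd := by
    haveI : ∀ j : Fin 3, Finite (BadStd j) := fun j => (hBadStd j).to_subtype
    exact Finite.instSigma
  haveI : Finite CondSt := by
    haveI : ∀ (t : S) (p : {j : Fin 3 // j ≠ iS t}), Finite (BadSt t p) := fun t p => (hBadSt t p).to_subtype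
    haveI : ∀ t : S, Finite (Σ p : {j : Fin 3 // j ≠ iS t}, BadSt t p) := fun t => Finite.instSigma
    exact Finite.instSigma
  -- the `k`-linear strict-transform chart maps
  let stk : (t : S) → (p : {j : Fin 3 // j ≠ iS t}) →
      (MvPolynomial (Fin 3) k →ₗ[k] MvPolynomial {j : Fin 3 // j ≠ iS t} k) := fun t p =>
    { toFun := fun F => MvPolynomial.divMonomial
        (aeval (fun j => if j = p then (X p : MvPolynomial {j : Fin 3 // j ≠ iS t} k) else X p * X j)
          (aeval (fun l => (X l : MvPolynomial {j : Fin 3 // j ≠ iS t} k) + C (π (aS t l))) (dehomogenize (iS t) F)))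
        (Finsupp.single p (mS t))
      map_add' := fun F G => by simp only [map_add, add_divMonomial]
      map_smul' := fun c F => by simp only [map_smul, smul_divMonomial, RingHom.id_apply] }
  have hstk : ∀ t p F, stk t p F = MvPolynomial.divMonomial
      (aeval (fun j => if j = p then (X p : MvPolynomial {j : Fin 3 // j ≠ iS t} k) else X p * X j)
        (aeval (fun l => (X l : MvPolynomial {j : Fin 3 // j ≠ iS t} k) + C (π (aS t l))) (dehomogenize (iS t) F)))
      (Finsupp.single p (mS t)) := fun _ _ _ => rfl
  -- the linear conditions, with uniform target `k[T_{τ κ}]`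
  let K : Type := CondStd ⊕ CondSt
  let τ : K → Type := Sum.elim (fun c : CondStd => {l : Fin 3 // l ≠ c.1}) (fun c : CondSt => {j : Fin 3 // j ≠ iS c.1})
  let L : (κ : K) → MvPolynomial (Fin 3) k →ₗ[k] MvPolynomial (τ κ) k := fun κ =>
    Sum.rec (motive := fun κ => MvPolynomial (Fin 3) k →ₗ[k] MvPolynomial (τ κ) k)
      (fun c => (dehomogenize c.1).toLinearMap) (fun c => stk c.1 c.2.1) κ
  let N : (κ : K) → Submodule k (MvPolynomial (τ κ) k) := fun κ =>
    Sum.rec (motive := fun κ => Submodule k (MvPolynomial (τ κ) k))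
      (fun c => c.2.1.asIdeal.restrictScalars k) (fun c => c.2.2.1.asIdeal.restrictScalars k) κ
  -- a witness for every condition
  have hpt : ∀ (t : Fin s), (Ideal.span (Set.range fun l : {l : Fin 3 // l ≠ i t} =>
      (X l : MvPolynomial {l : Fin 3 // l ≠ i t} k) -
        C ((if h : (l : Fin 3) = i t then (1 : k) else π (a t ⟨l, h⟩)) /
          (if h : i t = i t then (1 : k) else π (a t ⟨i t, h⟩))))) =
      Ideal.span (Set.range fun l : {l : Fin 3 // l ≠ i t} => (X l : MvPolynomial {l : Fin 3 // l ≠ i t} k) - C (π (a t l))) := by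
    intro t
    refine congrArg (fun f => Ideal.span (Set.range f)) (funext fun l => ?_)
    rw [dif_pos rfl, div_one, dif_neg l.2]
  have hwit : ∀ κ : K, ∃ w : MvPolynomial (Fin 3) k, w.IsHomogeneous dg ∧
      (∀ t : S, dehomogenize (iS t) w ∈
        (Ideal.span (Set.range fun l => (X l : MvPolynomial {l : Fin 3 // l ≠ iS t} k) - C (π (aS t l)))) ^ mS t) ∧
      L κ w ∉ N κ := by
    rintro (⟨j, 𝔮, hbad, hnotE⟩ | ⟨t, p, 𝔮, hbad, hXp⟩)
    · -- a bad prime off `E j` is the same-chart point of a non-`S` cluster point `t′`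
      obtain ⟨t', hât', h𝔮eq⟩ := hcover j 𝔮 hbad.1 hbad.2
      have hno : ¬ (t' ∈ S ∨ i t' ≠ j) := fun h => hnotE ⟨t', hât', h𝔮eq, h⟩
      have ht'S : t' ∉ S := fun h => hno (Or.inl h)
      have hij : i t' = j := by by_contra h; exact hno (Or.inr h)
      subst hij
      rw [hpt t'] at h𝔮eq
      -- `m t′ ≥ 1`, else `g ∉ 𝔪_{t′}` contradicts badness
      have hm1 : 1 ≤ m t' := by
        by_contra h0
        have h0' : m t' = 0 := by omega
        have hnot := (hord t').2
        rw [h0', zero_add, pow_one, ← h𝔮eq] at hnot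
        exact hnot hbad.1
      obtain ⟨w, hw, hwZ, hwpt⟩ := exists_form_notMem_point_of_clusterNonSuperabundant i (fun t j => π (a t j)) m hns t' hm1
      refine ⟨w, hw, fun t => hwZ t.1 (fun h => ht'S (h ▸ t.2)), ?_⟩
      change dehomogenize (i t') w ∉ (𝔮.asIdeal.restrictScalars k)
      rw [Submodule.restrictScalars_mem, h𝔮eq]
      exact hwpt
    · -- a bad prime of the strict transform ON the exceptional line: the tangent witness
      have htw' : ∀ v : (t' : S) → ({j : Fin 3 // j ≠ iS t'} →₀ ℕ) → k, ∃ g' : MvPolynomial (Fin 3) k, g'.IsHomogeneous dg ∧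
          ∀ t' α, α.degree < Function.update mS t (mS t + 1) t' →
            coeff α (aeval (fun j => (X j : MvPolynomial {j : Fin 3 // j ≠ iS t'} k) + C (π (aS t' j)))
              (dehomogenize (iS t') g')) = v t' α := by
        intro v
        obtain ⟨g', hg', h⟩ := clusterNonSuperabundant_mono S i (fun t j => π (a t j)) (Function.update m t.1 (m t.1 + 1)) (htw t.1) v
        exact ⟨g', hg', fun t' α hα => h t' α (by rwa [update_comp_subtype_apply] at hα)⟩
      obtain ⟨M, hM, hMZ, hMst⟩ := exists_clusterForm_stChart_sub_one_mem iS (fun t l => π (aS t l)) mS t p htw'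
      refine ⟨M, hM, hMZ, ?_⟩
      change stk t p M ∉ (𝔮.asIdeal.restrictScalars k)
      rw [Submodule.restrictScalars_mem, hstk]
      exact notMem_of_sub_one_mem_span_X (hst := hMst) (h𝔮 := 𝔮.isPrime.ne_top) (hX := hXp)
  -- ONE witness for all conditions
  obtain ⟨Mbar, hMbar, hMZ, hMcond⟩ := exists_clusterForm_forall_linear_notMem iS (fun t l => π (aS t l)) mS dg L N hwit
  have hMavoid : ∀ (j : Fin 3) (𝔮 : PrimeSpectrum (MvPolynomial {l : Fin 3 // l ≠ j} k)), 𝔮 ∉ E j →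
      dehomogenize j g ∈ 𝔮.asIdeal →
      algebraMap (MvPolynomial {l : Fin 3 // l ≠ j} k) (Localization.AtPrime 𝔮.asIdeal) (dehomogenize j g) ∈
        maximalIdeal (Localization.AtPrime 𝔮.asIdeal) ^ 2 →
      dehomogenize j Mbar ∉ 𝔮.asIdeal :=
    fun j 𝔮 hE h1 h2 hmem => hMcond (Sum.inl ⟨j, 𝔮, ⟨h1, h2⟩, hE⟩) hmem
  have hMst : ∀ (t : S) (p : {j : Fin 3 // j ≠ iS t}), (X p : MvPolynomial {j : Fin 3 // j ≠ iS t} k) ^ mS t * stk t p Mbar =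
      aeval (fun j => if j = p then (X p : MvPolynomial {j : Fin 3 // j ≠ iS t} k) else X p * X j)
        (aeval (fun l => (X l : MvPolynomial {j : Fin 3 // j ≠ iS t} k) + C (π (aS t l))) (dehomogenize (iS t) Mbar)) :=
    fun t p => by rw [hstk]; exact X_pow_mul_divMonomial_eq_of_mem p (blowupSubst_shift_mem_span_X_pow p _ (hMZ t))
  have hMstavoid : ∀ (t : S) (p : {j : Fin 3 // j ≠ iS t}) (𝔮 : PrimeSpectrum (MvPolynomial {j : Fin 3 // j ≠ iS t} k)),
      𝔮 ∉ E' t p → gst t p ∈ 𝔮.asIdeal →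
      algebraMap (MvPolynomial {j : Fin 3 // j ≠ iS t} k) (Localization.AtPrime 𝔮.asIdeal) (gst t p) ∈
        maximalIdeal (Localization.AtPrime 𝔮.asIdeal) ^ 2 →
      stk t p Mbar ∉ 𝔮.asIdeal := by
    intro t p 𝔮 hE' h1 h2 hmem
    have hXp : (X p : MvPolynomial {j : Fin 3 // j ≠ iS t} k) ∈ 𝔮.asIdeal := by
      by_contra h
      exact hE' h
    exact hMcond (Sum.inr ⟨t, p, 𝔮, ⟨h1, h2⟩, hXp⟩) hmem
  -- part 9
  obtain ⟨Φ, hΦd, hΦg, hΦcen, hΦstd, hΦst⟩ := exists_isHomogeneous_clusterLift_deltaRegular_stCharts hϖ π hπ hker iS aS mS hind g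
    hg hgZ E hfin gst hgst E' hfinst Mbar hMbar hMZ hMavoid (fun t p => stk t p Mbar) hMst hMstavoid
  refine ⟨Φ, hΦd, hΦg, fun t ht => hΦcen ⟨t, ht⟩, fun t ht => ?_, fun j Q _ hQϖ hQE => ?_, fun t ht p => ?_⟩
  · -- exactness: a unit coefficient in order `m t`
    obtain ⟨α, hα, hαc⟩ := exists_coeff_ne_zero_of_not_mem_pow (fun l => π (a t l)) (hord t).1 (hord t).2
    refine ⟨α, hα, ?_⟩
    have hmap : MvPolynomial.map π (aeval (fun l => (X l : MvPolynomial {j : Fin 3 // j ≠ i t} O) + C (a t l))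
        (dehomogenize (i t) Φ)) =
        aeval (fun l => (X l : MvPolynomial {j : Fin 3 // j ≠ i t} k) + C (π (a t l))) (dehomogenize (i t) g) := by
      rw [map_aeval_of_map_comp π _ _ (fun l => by rw [map_add, map_X, map_C]), map_dehomogenize, hΦg]
    have hπc : π (coeff α (aeval (fun l => (X l : MvPolynomial {j : Fin 3 // j ≠ i t} O) + C (a t l)) (dehomogenize (i t) Φ))) ≠ 0 := by
      rw [← coeff_map, hmap]
      exact hαc
    by_contra hu
    apply hπc
    rw [← RingHom.mem_ker, hker, ← hϖ.maximalIdeal_eq]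
    exact (IsLocalRing.mem_maximalIdeal _).mpr hu
  · -- standard chart
    refine hΦstd j Q hQϖ fun 𝔮 h𝔮E => ?_
    obtain ⟨t, hât, h𝔮eq, hor⟩ := h𝔮E
    rw [h𝔮eq]
    exact hQE t hât hor
  · -- strict-transform chart at `t ∈ S`
    obtain ⟨Φst, hΦst, -, hreg⟩ := hΦst ⟨t, ht⟩ p
    refine ⟨Φst, hΦst, fun Q _ hQϖ hQX => hreg Q hQϖ fun 𝔮 h𝔮E' heq => h𝔮E' ?_⟩
    have hX : (X p : MvPolynomial {j : Fin 3 // j ≠ i t} O) ∈ Q.comap (Ideal.Quotient.mk (Ideal.span {Φst})) := hQX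
    rw [← heq, Ideal.mem_comap, map_X] at hX
    exact hX

end Summit.ResolutionOfSingularities.ResolutionOfSingularities.Cruxes.EquisingularLiftNat.Sections

end
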